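import Summits.BirchSwinnertonDyer.BirchSwinnertonDyer.Theorems.EisensteinPrimesMazurMCOnCellBMudescentV4
import HarnessLib

/-!
# Crux `MazurMCOnCellB` (stmt-BirchSwinnertonDyer-19033), line `mudescent` v4 — the route's NEW
# conjecture item `AnalyticMuZeroOffLocus` (stmt-BirchSwinnertonDyer-27407, Vatsal 2005 Conj. 1.14 (2)
# at `r = 0`) discharges stub 3′ BY NAME; the crux BY NAME from PUB ∧ Prop. 3.10 ∧ that item ∧ stub 4″

Width seat bsd-line-x2-p1-w2 (gen 5), `--supports -19033 --as helper`, μ-lineage. THEOREMS ONLY (no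
definition, no named fact, no `sorry`); the file CLOSES NOTHING: the crux is obtained only RELATIVE
TO the route's conjecture-tagged support item `Summit.….Theses.EisensteinPrimes.AnalyticMuZeroOffLocus`
(route rev 19, 2026-08-28T10:35Z; an OPEN PRINTED CONJECTURE — Vatsal, J. Inst. Math. Jussieu 4 (2005)
Conj. 1.14 (2) at `r = 0`, p. 11: «it is not known that the lower bound … is actually sharp») and to
the OPEN registered stub 4″ `stub_lambdaCountWeak_offLocus`, both taken AS HYPOTHESES, together with
`PublishedInputs` (item -19037) and Greenberg's Prop. 3.10 (tree named fact). Its point is wiring: the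
μ-half of line `mudescent` now hangs off ONE NAMED ledger item in the kernel.

* `analyticMuZeroOffLocus_iff` — the item, which unfolds `HasRamifiedOddLineAt` and `X2.AnalyticMuLE`
  in the bare route context, IS the expired v3 stub `stub_analyticMuZero_offLocus` verbatim
  (`∀` X2b pairs off the locus, `X2.AnalyticMuLE W₀ p 0`): `Iff.rfl`.
* `muPart_offLocus_of_analyticMuZeroOffLocus` — **item -27407 ⟹ stub 3′ `stub_muPart_offLocus`**
  (signature VERBATIM as registered on skeleton v4 460ece00): per pair this is the width seat gen 2's
  `…MuPartTight.muPart_of_analyticMuLE_zero` (`μ(G) = 0 ≤ μ(g)`, no named fact).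
* `mazurMCOnCellB_of_analyticMuZeroOffLocus_of_lambdaCountWeak_offLocus` — **the crux BY NAME from
  `PublishedInputs` ∧ Prop. 3.10 ∧ item -27407 ∧ stub 4″** (= LEAD g2's registered v4 composition
  `…MudescentV4.mazurMCOnCellB_of_muPart_offLocus_of_lambdaCountWeak_offLocus` with its `hμ` fed by
  the previous theorem).
* `analyticMuZeroOffLocus_of_mazurMCOnCellB_of_greenbergMu` is NOT here: the converse needs
  Greenberg's Conj. 1.11 at the étale ends (`…MuPartTightCrux.stub_analyticMuZero_offLocus_iff_muPart_and_greenberg`).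

HONEST FRAMING: a conditional wiring theorem; no main conjecture / BSD statement is proved for any
curve; stub 3′ stays OPEN (it is implied by, not equivalent to, the conjecture item); 0 cells / labels
/ stubs / tiers move. References: [Vatsal2005] Conj. 1.14, Thm. 1.16, p. 11;
[GreenbergVatsal2000] p. 2 (1)–(2); [GreenbergLNM1716] Prop. 3.10 (p. 82), Conj. 1.11; [Wuthrich2014]
Thm. 16.
-/

set_option autoImplicit false

-- `Summit.BirchSwinnertonDyer.BirchSwinnertonDyer.…`: the summit and its single sub-problem share a name (D-0017 layout).
set_option linter.dupNamespace false

noncomputable section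

open scoped Classical MatrixGroups ModularForm

open PowerSeries CongruenceSubgroup WeierstrassCurve
  Literature.NumberTheory.EllipticCurves
  Literature.NumberTheory.EllipticCurves.ModularForms
  Literature.NumberTheory.EllipticCurves.Rank1Residual
  Literature.NumberTheory.EllipticCurves.Wuthrich2014
  Literature.NumberTheory.EllipticCurves.Greenberg1999
  Summit.BirchSwinnertonDyer.Rank1Residual
  Summit.BirchSwinnertonDyer.Rank1Residual.X1.MuLambda
  Summit.BirchSwinnertonDyer.Rank1Residual.X1.TamagawaSqueeze
  Summit.BirchSwinnertonDyer.BirchSwinnertonDyer.Theses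
  Summit.BirchSwinnertonDyer.BirchSwinnertonDyer.Theorems.EisensteinPrimesMazurMCOnCellBMuPartTight
  Summit.BirchSwinnertonDyer.BirchSwinnertonDyer.Theorems.EisensteinPrimesMazurMCOnCellBMudescentV4

open Literature.Barriers.BirchSwinnertonDyer (HasRamifiedOddLineAt)

namespace Summit.BirchSwinnertonDyer.BirchSwinnertonDyer.Theorems.EisensteinPrimesMazurMCOnCellBOfAnalyticMuConjecture

/-- **The conjecture item IS the expired v3 stub, verbatim.** `EisensteinPrimes.AnalyticMuZeroOffLocus`
(route file, with `HasRamifiedOddLineAt` and `X2.AnalyticMuLE` unfolded because the route file does not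
import their homes) is definitionally `∀` X2b pairs `(W₀, p)` off the barrier locus,
`X2.AnalyticMuLE W₀ p 0` («μ_an(E₀, p) = 0»: some coefficient of `ϖ·L_p` has norm `> p⁻¹`).
[cite: Vatsal2005, Conj. 1.14 (2) and p. 11] -/
theorem analyticMuZeroOffLocus_iff :
    EisensteinPrimes.AnalyticMuZeroOffLocus ↔
      ∀ (W₀ : WeierstrassCurve ℚ) [W₀.IsElliptic] [W₀.IsGloballyMinimal] (p : ℕ) [Fact p.Prime],
        X2.CellB W₀ p → ¬ HasRamifiedOddLineAt W₀ p → X2.AnalyticMuLE W₀ p 0 :=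
  Iff.rfl

/-- **Item -27407 ⟹ stub 3′ of `mudescent` v4 (`stub_muPart_offLocus`, signature verbatim).** At
each X2b étale end the conjecture gives `X2.AnalyticMuLE W₀ p 0`, and a `μ_an = 0` certificate
discharges the μ-part `μ(G) ≤ μ(g)` with no named fact (`…MuPartTight.muPart_of_analyticMuLE_zero`:
`μ(G) = 0`). [cite: Vatsal2005, Conj. 1.14 (2)] [cite: GreenbergVatsal2000, p. 2, (2)] -/
theorem muPart_offLocus_of_analyticMuZeroOffLocus (hV : EisensteinPrimes.AnalyticMuZeroOffLocus) :
    ∀ (W₀ : WeierstrassCurve ℚ) [W₀.IsElliptic] [W₀.IsGloballyMinimal] (p : ℕ) [Fact p.Prime],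
      X2.CellB W₀ p → ¬ HasRamifiedOddLineAt W₀ p →
      ∀ (κ : ZpExtension ℚ p) (γ : Field.absoluteGaloisGroup ℚ),
        κ.IsCyclotomic → κ.IsTopGenerator γ → IsCyclotomicVariable p γ →
        ∀ {N : ℕ} [NeZero N] (f : CuspForm (Gamma0 N) 2), IsNewformOf W₀ f →
        ∀ (ϖ : ℚ), (ϖ : ℝ) * W₀.realPeriodRat = plusPeriod f →
        ∀ (L : PowerSeries ℚ_[p]),
          (W₀.HasSplitMultiplicativeReductionAtPrime p → IsSplitMultPAdicLFunctionOf f p L) →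
          (¬ W₀.HasSplitMultiplicativeReductionAtPrime p → IsMultPAdicLFunctionOf f p (-1) L) →
        ∀ (D : W₀.SelmerDualData κ γ) (g G : IwasawaAlgebra p), D.charIdeal = Ideal.span {g} →
          iwasawaToPowerSeries p G = PowerSeries.C ((ϖ : ℚ) : ℚ_[p]) * L → mu G ≤ mu g :=
  fun W₀ _ _ p _ hc hoff ↦
    muPart_of_analyticMuLE_zero ((analyticMuZeroOffLocus_iff.mp hV) W₀ p hc hoff)

/-- **Crux 3 `MazurMCOnCellB` BY NAME from `PublishedInputs` ∧ Greenberg's Prop. 3.10 ∧ the conjecture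
item `AnalyticMuZeroOffLocus` (-27407) ∧ stub 4″ `stub_lambdaCountWeak_offLocus`** (the registered v4
composition `…MudescentV4.mazurMCOnCellB_of_muPart_offLocus_of_lambdaCountWeak_offLocus` of LEAD g2,
its μ-stub fed by the item). CONDITIONAL: the item is an open printed conjecture and stub 4″ is open;
both enter as hypotheses; nothing is proved about any curve.
[cite: Vatsal2005, Conj. 1.14 (2), Thm. 1.16, p. 11] [cite: GreenbergLNM1716, Prop. 3.10 (p. 82)]
[cite: Wuthrich2014, Thm. 16 (p. 397)] -/
theorem mazurMCOnCellB_of_analyticMuZeroOffLocus_of_lambdaCountWeak_offLocus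
    (hP : EisensteinPrimes.PublishedInputs)
    (h310 : prop310_selmerCorank_mod_two_eq_lambdaInvariant)
    (hV : EisensteinPrimes.AnalyticMuZeroOffLocus)
    (hl : ∀ (W₀ : WeierstrassCurve ℚ) [W₀.IsElliptic] [W₀.IsGloballyMinimal] (p : ℕ) [Fact p.Prime],
      X2.CellB W₀ p → ¬ HasRamifiedOddLineAt W₀ p →
        ∃ n k : ℕ, X2.AnalyticLambdaEq W₀ p n ∧ AlgebraicLambdaGE W₀ p k ∧
          (¬ W₀.HasSplitMultiplicativeReductionAtPrime p → n ≤ k + 1) ∧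
          (W₀.HasSplitMultiplicativeReductionAtPrime p → n ≤ k + 2)) :
    EisensteinPrimes.MazurMCOnCellB :=
  mazurMCOnCellB_of_muPart_offLocus_of_lambdaCountWeak_offLocus hP h310
    (muPart_offLocus_of_analyticMuZeroOffLocus hV) hl

end Summit.BirchSwinnertonDyer.BirchSwinnertonDyer.Theorems.EisensteinPrimesMazurMCOnCellBOfAnalyticMuConjecture

end
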